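import Summits.QuantumFields.YangMills.Theorems.DiagonalMirrorRPRWilsonDiagonalModelPairingDefs

/-!
# Crux `WeakCouplingHypercubicLimitRP` (stmt-QuantumFields-27398) / aside `DiagonalMirrorRPR` (stmt-QuantumFields-10604), door B,
# construction F1_diag — step A1: ★★ ALL FIELDS OF `DiagonalSliceModel` AT ONE SCHEME INDEX (the slice theorem)

Helper file (`--supports stmt-QuantumFields-27398 --as helper`) of the hand `hand-10604-wilsonDiagModel-2` (docket director-ym O4 WORD 16 (1) /
28, step A of hand-1's ROADMAP-F1diag v4 §1⅞); it closes nothing by itself.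

WHAT.  ★★ **`nonempty_sliceFields`**: for every scheme index `k` with `β_k ≥ 0` and `side_k ≥ 3`, the structure `SliceFields r sch k` of
`…PairingDefs` — the nine spectral fields AND, for every reflected family `F`, non-negative bounded Gram weights with the PAIRING IDENTITY
`⟨ΘY·Y⟩_k · (Σ sp^S − Σ sm^S) = Σ sp^{S−2D} wp − Σ sm^{S−2D} wm` and the WEIGHT DOMINATION `Σ sp^{2t} wp + Σ sm^{2t} wm ≤ ‖Y‖_∞² (Σ sp^{2t+2D} + Σ sm^{2t+2D})`
at depth `D = d_k + 2`, in the eventual regime — is INHABITED by Wilson's measure on the scheme's own odd torus: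
spectral data = the padded signed eigenvalues of hand-1's compact self-adjoint realisation of the two-step diagonal transfer matrix
(`SlicePkg`, `spectralData_of_hasSum`); weights = `κᵢ² ⟪bᵢ, 𝒲_F bᵢ⟫` with the Gram block operator of the family observable read on
`d_k + 1` layers (`famRead`, `blockKernel`); positivity = `…GramPSD`; the identities = the one-insertion trace formula `…SpectralPairing` at chain
lengths `S_k` (pairing) and `2t + 2d_k + 4` (domination) + hand-2's insertion form `gramPairing_mul_diagCyclicTraceU_eq_integral_pairs` +
hand-1's trace identities.
* §1 padding bookkeeping (`extend` along the index injection: products, bounds, sums);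
* §2 the slice theorem.

HONEST FRAMING: the model at one index; `def wilsonDiagonalModel` is the next file; no letter (R1 `OddTwistGap`, R2 `DiagLukewarm`) is proved; D1,
⟨27398⟩, S6i and the aside ⟨10604⟩ are OPEN; nothing here bears on the summit; the Yang–Mills mass gap is NOT proved here or anywhere in the tree.
No definition, no instance, no notation, `autoImplicit false`.

References: K. Osterwalder, E. Seiler, Ann. Phys. 110 (1978) §2–3; E. Seiler, LNP 159 (1982) Ch. 2; B. Simon, *Trace Ideals* (2005) Ch. 3.
-/

set_option autoImplicit false

noncomputable section

open scoped BigOperators ENNReal RealInnerProductSpace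
open MeasureTheory Function Filter Topology
open Literature.MathematicalPhysics.QuantumLattice Literature.MathematicalPhysics.QuantumFieldTheory
open Summit.QuantumFields.YangMills.Cruxes.DiagonalMirrorRPR.ParityBridgeColdTraces

namespace Summit.QuantumFields.YangMills.Cruxes.DiagonalMirrorRPR.SignTwistedDiagonalTrace.WilsonDiagonal

/-! ## §1 Padding bookkeeping -/

section Pad

variable {ι : Type} {emb : ι → ℕ}

/-- Products of zero-extensions along an injection are zero-extensions of products (the first factor raised to any power). -/
theorem pow_extend_mul_extend (he : Function.Injective emb) (g h : ι → ℝ) (n : ℕ) :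
    (fun j => Function.extend emb g 0 j ^ n * Function.extend emb h 0 j) = Function.extend emb (fun i => g i ^ n * h i) 0 := by
  funext j
  by_cases hj : ∃ i, emb i = j
  · obtain ⟨i, rfl⟩ := hj
    rw [he.extend_apply, he.extend_apply, he.extend_apply]
  · rw [Function.extend_apply' _ _ _ hj, Function.extend_apply' _ _ _ hj, Function.extend_apply' _ _ _ hj, Pi.zero_apply, mul_zero]

/-- A zero-extension of a family bounded by `W ≥ 0` is bounded by `W`. -/
theorem extend_le_of_le (g : ι → ℝ) {W : ℝ} (hW : 0 ≤ W) (hg : ∀ i, g i ≤ W) (he : Function.Injective emb) (j : ℕ) :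
    Function.extend emb g 0 j ≤ W := by
  by_cases hj : ∃ i, emb i = j
  · obtain ⟨i, rfl⟩ := hj
    rw [he.extend_apply]; exact hg i
  · rw [Function.extend_apply' _ _ _ hj, Pi.zero_apply]; exact hW

/-- A zero-extension of a non-negative family is non-negative. -/
theorem extend_nonneg (g : ι → ℝ) (hg : ∀ i, 0 ≤ g i) (he : Function.Injective emb) (j : ℕ) : 0 ≤ Function.extend emb g 0 j := by
  by_cases hj : ∃ i, emb i = j
  · obtain ⟨i, rfl⟩ := hj
    rw [he.extend_apply]; exact hg i
  · rw [Function.extend_apply' _ _ _ hj, Pi.zero_apply]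

/-- Sums of zero-extensions: `Σ'_j extend emb g 0 j = Σ'_i g i` for a summable `g`. -/
theorem tsum_extend_eq (he : Function.Injective emb) {g : ι → ℝ} (hg : Summable g) :
    ∑' j, Function.extend emb g 0 j = ∑' i, g i :=
  ((hasSum_extend_zero he).2 hg.hasSum).tsum_eq

end Pad

/-! ## §2 ★★ The slice theorem -/

section Slice

variable {G : Type} [Group G] [TopologicalSpace G] [IsTopologicalGroup G] [CompactSpace G] [MeasurableSpace G] [BorelSpace G]
  (r : LatticeRep G) (sch : SpeciesScheme (YMSpecies G))

/-- ★★ **The slice theorem**: all fields of `DiagonalSliceModel r sch` at a scheme index `k` with `β_k ≥ 0` and `side_k ≥ 3` are realised by Wilson's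
measure on the scheme's own odd torus (spectral data of the two-step diagonal transfer matrix; Gram weights of the block operators of reflected
families; pairing identity and weight domination from the one-insertion trace formula, in the eventual regime). -/
theorem nonempty_sliceFields (k : ℕ) (hβ : 0 ≤ sch.β k) (h3 : 3 ≤ sch.side k) : Nonempty (SliceFields r sch k) := by
  haveI : SecondCountableTopology G := (r.continuous.isClosedEmbedding r.injective).isEmbedding.secondCountableTopology
  have hS : Odd (sch.side k) := ⟨sch.L k, rfl⟩
  obtain ⟨P⟩ := nonempty_slicePkg (S := sch.side k) (Nc := r.N) (ρ := r.ρ) r.continuous hβ r.mem_unitary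
  haveI := P.countable
  haveI := isFiniteMeasure_tMeasure (S := sch.side k) (G := G) (Nc := r.N) hβ P.M
  have he := P.emb_injective
  obtain ⟨top, htop, hsp0, hsm0, hsple, hsmle, hatt, hsum_sp, hsum_sm, hdisj, htrace, hodd, hside⟩ :=
    spectralData_of_hasSum (S := sch.side k) (G := G) r.ρ hS h3 r.continuous (sch.β k) he P.summable_sq P.trace
  have hκA : ∀ i, |P.κ i| ≤ ‖P.A‖ := Literature.Analysis.OperatorTheory.abs_lam_le_norm P.hb
  -- per-family data: observable of depth `d_k + 1`, its bound, its block operator, the Gram weights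
  have hfam : ∀ F : ReflectedFamily, ∃ (B : ℝ) (W : Lp ℝ 2 (tMeasure (sch.side k) G r.N (sch.β k) P.M) →L[ℝ]
      Lp ℝ 2 (tMeasure (sch.side k) G r.N (sch.β k) P.M)),
      (∀ V, |famObs r sch F k V| ≤ B) ∧
      (∀ φ, (W φ : ℕ × HalfCfg (sch.side k) (sch.side k) G → ℝ) =ᵐ[tMeasure (sch.side k) G r.N (sch.β k) P.M]
        fun x => ∫ y, blockKernel (sch.side k) G r.N r.ρ (sch.β k) P.M (famRead r sch F k (famDepthSeq r sch F k)) x y * φ y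
          ∂(tMeasure (sch.side k) G r.N (sch.β k) P.M)) ∧
      (∀ i, P.gram (famRead r sch F k (famDepthSeq r sch F k)) i = ⟪P.b i, W (P.b i)⟫) ∧
      (∀ i, 0 ≤ P.weight (famRead r sch F k (famDepthSeq r sch F k)) i) ∧
      (∀ i, P.weight (famRead r sch F k (famDepthSeq r sch F k)) i ≤ (∑' j, P.κ j ^ 2) * ‖W‖) ∧
      (∀ n, Summable fun i => P.κ i ^ n * P.weight (famRead r sch F k (famDepthSeq r sch F k)) i) := by
    intro F
    obtain ⟨B, hB⟩ := exists_abs_famObs_le r sch F k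
    have hf := measurable_famRead r sch F k (famDepthSeq r sch F k)
    have hfB := abs_famRead_le r sch F k (famDepthSeq r sch F k) hB
    obtain ⟨W, hW⟩ := exists_blockKernelOp (S := sch.side k) (Nc := r.N) r.ρ r.continuous hβ P.hM hf hfB
    have hgram : ∀ i, P.gram (famRead r sch F k (famDepthSeq r sch F k)) i = ⟪P.b i, W (P.b i)⟫ := fun i => by
      rw [Literature.Analysis.OperatorTheory.inner_kernelOp_eq_integral hW]; rfl
    have hw0 : ∀ i, 0 ≤ P.weight (famRead r sch F k (famDepthSeq r sch F k)) i := fun i => by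
      unfold SlicePkg.weight
      rw [hgram]
      exact mul_nonneg (sq_nonneg _) (inner_blockKernelOp_self_nonneg r.ρ r.continuous hβ P.hM hf hfB hW _)
    have hwle : ∀ i, P.weight (famRead r sch F k (famDepthSeq r sch F k)) i ≤ (∑' j, P.κ j ^ 2) * ‖W‖ := fun i => by
      unfold SlicePkg.weight
      rw [hgram]
      exact mul_le_mul (P.summable_sq.le_tsum i fun j _ => sq_nonneg _) ((le_abs_self _).trans (abs_inner_basis_le_opNorm P.b W i))
        ((hgram i) ▸ (hgram i ▸ inner_blockKernelOp_self_nonneg r.ρ r.continuous hβ P.hM hf hfB hW _)) (tsum_nonneg fun j => sq_nonneg _)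
    have hsumw : ∀ n, Summable fun i => P.κ i ^ n * P.weight (famRead r sch F k (famDepthSeq r sch F k)) i := fun n => by
      refine Summable.of_norm_bounded (g := fun i => ‖P.A‖ ^ n * (‖W‖ * P.κ i ^ 2)) ((P.summable_sq.mul_left _).mul_left _) fun i => ?_
      rw [Real.norm_eq_abs, abs_mul, abs_pow]
      refine mul_le_mul (pow_le_pow_left₀ (abs_nonneg _) (hκA i) n) ?_ (abs_nonneg _) (by positivity)
      unfold SlicePkg.weight
      rw [abs_mul, abs_of_nonneg (sq_nonneg _), hgram, mul_comm]
      exact mul_le_mul_of_nonneg_right (abs_inner_basis_le_opNorm P.b W i) (sq_nonneg _)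
    exact ⟨B, W, hB, hW, hgram, hw0, hwle, hsumw⟩
  choose Bf Wf hBf hWf hgramf hw0f hwlef hsumwf using hfam
  -- notation
  set sp : ℕ → ℝ := posPad P.emb P.κ with hspdef
  set sm : ℕ → ℝ := negPad P.emb P.κ with hsmdef
  set w : ReflectedFamily → P.s → ℝ := fun F i => P.weight (famRead r sch F k (famDepthSeq r sch F k)) i with hwdef
  -- the padded weighted sums
  have hpos_sum : ∀ (F : ReflectedFamily) (n : ℕ), ∑' j, sp j ^ n * P.wp (famRead r sch F k (famDepthSeq r sch F k)) j =
      ∑' i, (if 0 < P.κ i then P.κ i ^ n * w F i else 0) := by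
    intro F n
    have hfun : (fun j => sp j ^ n * P.wp (famRead r sch F k (famDepthSeq r sch F k)) j) =
        Function.extend P.emb (fun i => if 0 < P.κ i then P.κ i ^ n * w F i else 0) 0 := by
      rw [hspdef, posPad, SlicePkg.wp, pow_extend_mul_extend he]
      congr 1
      funext i
      split_ifs with h
      · rw [max_eq_left h.le]
      · rw [mul_zero]
    rw [hfun, tsum_extend_eq he]
    refine Summable.of_norm_bounded (g := fun i => ‖P.κ i ^ n * w F i‖) (hsumwf F n).norm fun i => ?_
    split_ifs
    · exact le_rfl
    · rw [norm_zero]; exact norm_nonneg _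
  have hneg_sum : ∀ (F : ReflectedFamily) (n : ℕ), ∑' j, sm j ^ n * P.wm (famRead r sch F k (famDepthSeq r sch F k)) j =
      ∑' i, (if P.κ i < 0 then (-P.κ i) ^ n * w F i else 0) := by
    intro F n
    have hfun : (fun j => sm j ^ n * P.wm (famRead r sch F k (famDepthSeq r sch F k)) j) =
        Function.extend P.emb (fun i => if P.κ i < 0 then (-P.κ i) ^ n * w F i else 0) 0 := by
      rw [hsmdef, negPad, SlicePkg.wm, pow_extend_mul_extend he]
      congr 1
      funext i
      split_ifs with h
      · rw [max_eq_left (neg_nonneg.2 h.le)]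
      · rw [mul_zero]
    rw [hfun, tsum_extend_eq he]
    refine Summable.of_norm_bounded (g := fun i => ‖P.κ i ^ n * w F i‖) (hsumwf F n).norm fun i => ?_
    split_ifs
    · rw [norm_mul, norm_mul, norm_pow, norm_pow, norm_neg]
    · rw [norm_zero]; exact norm_nonneg _
  -- ★ the spectral sums of the weights: odd exponents (pairing) and even exponents (domination)
  have hodd_sum : ∀ (F : ReflectedFamily) (n : ℕ), Odd n →
      ∑' j, sp j ^ n * P.wp (famRead r sch F k (famDepthSeq r sch F k)) j -
        ∑' j, sm j ^ n * P.wm (famRead r sch F k (famDepthSeq r sch F k)) j = ∑' i, P.κ i ^ n * w F i := by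
    intro F n hn
    rw [hpos_sum, hneg_sum]
    have hs1 : Summable fun i => if 0 < P.κ i then P.κ i ^ n * w F i else 0 :=
      Summable.of_norm_bounded (g := fun i => ‖P.κ i ^ n * w F i‖) (hsumwf F n).norm fun i => by
        split_ifs
        · exact le_rfl
        · rw [norm_zero]; exact norm_nonneg _
    have hs2 : Summable fun i => if P.κ i < 0 then (-P.κ i) ^ n * w F i else 0 :=
      Summable.of_norm_bounded (g := fun i => ‖P.κ i ^ n * w F i‖) (hsumwf F n).norm fun i => by
        split_ifs
        · rw [norm_mul, norm_mul, norm_pow, norm_pow, norm_neg]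
        · rw [norm_zero]; exact norm_nonneg _
    rw [← hs1.tsum_sub hs2]
    refine tsum_congr fun i => ?_
    rcases lt_trichotomy (P.κ i) 0 with h | h | h
    · rw [if_neg (not_lt.2 h.le), if_pos h, hn.neg_pow]; ring
    · rw [if_neg (by rw [h]; exact lt_irrefl _), if_neg (by rw [h]; exact lt_irrefl _), h,
        zero_pow (by rintro rfl; exact (Nat.not_odd_zero hn).elim)]; ring
    · rw [if_pos h, if_neg (not_lt.2 h.le)]; ring
  have heven_sum : ∀ (F : ReflectedFamily) (t : ℕ),
      ∑' j, sp j ^ (2 * t) * P.wp (famRead r sch F k (famDepthSeq r sch F k)) j +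
        ∑' j, sm j ^ (2 * t) * P.wm (famRead r sch F k (famDepthSeq r sch F k)) j = ∑' i, P.κ i ^ (2 * t) * w F i := by
    intro F t
    rw [hpos_sum, hneg_sum]
    have hs1 : Summable fun i => if 0 < P.κ i then P.κ i ^ (2 * t) * w F i else 0 :=
      Summable.of_norm_bounded (g := fun i => ‖P.κ i ^ (2 * t) * w F i‖) (hsumwf F (2 * t)).norm fun i => by
        split_ifs
        · exact le_rfl
        · rw [norm_zero]; exact norm_nonneg _
    have hs2 : Summable fun i => if P.κ i < 0 then (-P.κ i) ^ (2 * t) * w F i else 0 :=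
      Summable.of_norm_bounded (g := fun i => ‖P.κ i ^ (2 * t) * w F i‖) (hsumwf F (2 * t)).norm fun i => by
        split_ifs
        · rw [norm_mul, norm_mul, norm_pow, norm_pow, norm_neg]
        · rw [norm_zero]; exact norm_nonneg _
    rw [← hs1.tsum_add hs2]
    refine tsum_congr fun i => ?_
    rcases lt_trichotomy (P.κ i) 0 with h | h | h
    · rw [if_neg (not_lt.2 h.le), if_pos h, (even_two_mul t).neg_pow]; ring
    · have hw00 : w F i = 0 := by
        simp only [hwdef, SlicePkg.weight, h]; ring
      rw [if_neg (by rw [h]; exact lt_irrefl _), if_neg (by rw [h]; exact lt_irrefl _), hw00]; ring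
    · rw [if_pos h, if_neg (not_lt.2 h.le)]; ring
  -- ★ the spectral sums as chain integrals: `Σ κ^n w = Σ κ^{n+2} ⟪b, 𝒲 b⟫ = ∫ Θf f ∏` on the chain of length `n + 2 d_k + 4`
  have hchain : ∀ (F : ReflectedFamily) (n : ℕ) {m : ℕ} [NeZero m], m = n + 2 * famDepthSeq r sch F k + 4 →
      ∑' i, P.κ i ^ n * w F i =
        ∫ Q : ZMod m → HalfCfg (sch.side k) (sch.side k) G × HalfCfg (sch.side k) (sch.side k) G,
          obsL (famRead r sch F k (famDepthSeq r sch F k)) Q * obsR (famRead r sch F k (famDepthSeq r sch F k)) Q *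
            ∏ t : ZMod m, Real.exp (sch.β k * evenActionU r.ρ (Q t).1 (Q t).2 (Q (t + 1)).1) *
              Real.exp (sch.β k * oddActionU r.ρ (Q t).2 (Q (t + 1)).1 (Q (t + 1)).2)
          ∂(Measure.pi fun _ => (halfHaar (sch.side k) G).prod (halfHaar (sch.side k) G)) := by
    intro F n m _ hm
    have h := hasSum_pow_mul_inner_blockKernelOp (S := sch.side k) (Nc := r.N) r.ρ r.continuous hβ r.mem_unitary P.hM P.hA P.hb
      (measurable_famRead r sch F k (famDepthSeq r sch F k)) (abs_famRead_le r sch F k (famDepthSeq r sch F k) (hBf F)) (hWf F) n hm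
    rw [← h.tsum_eq]
    refine tsum_congr fun i => ?_
    simp only [hwdef, SlicePkg.weight, hgramf]
    ring
  -- assemble the structure
  refine ⟨{
    sp := sp
    sm := sm
    top := top
    top_pos := htop
    sp_nonneg := hsp0
    sm_nonneg := hsm0
    sp_le := hsple
    sm_le := hsmle
    top_attained := hatt
    summable_sp := hsum_sp
    summable_sm := hsum_sm
    trace_nonneg := hodd
    trace_side_pos := hside
    wp := fun F => P.wp (famRead r sch F k (famDepthSeq r sch F k))
    wm := fun F => P.wm (famRead r sch F k (famDepthSeq r sch F k))
    wp_nonneg := fun F j => extend_nonneg _ (fun i => by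
      split_ifs; exacts [hw0f F i, le_rfl]) he j
    wm_nonneg := fun F j => extend_nonneg _ (fun i => by
      split_ifs; exacts [hw0f F i, le_rfl]) he j
    w_bdd := fun F => ?_
    pairing := fun F h26 hdep => ?_
    dom := fun F h26 hdep t B hB => ?_ }⟩
  · -- bounded weights
    have hW0 : 0 ≤ (∑' j, P.κ j ^ 2) * ‖Wf F‖ := mul_nonneg (tsum_nonneg fun j => sq_nonneg _) (norm_nonneg _)
    refine ⟨(∑' j, P.κ j ^ 2) * ‖Wf F‖, fun j => ⟨?_, ?_⟩⟩
    · exact extend_le_of_le _ hW0 (fun i => by split_ifs; exacts [hwlef F i, hW0]) he j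
    · exact extend_le_of_le _ hW0 (fun i => by split_ifs; exacts [hwlef F i, hW0]) he j
  · -- ★ the pairing identity at chain length `S_k`
    set e := famDepthSeq r sch F k with hedef
    have hn : Odd (sch.side k - 2 * (e + 2)) := by
      obtain ⟨L, hL⟩ := hS
      exact ⟨L - e - 2, by omega⟩
    rw [hodd_sum F _ hn]
    haveI : NeZero (sch.side k) := ⟨by omega⟩
    rw [hchain F (sch.side k - 2 * (e + 2)) (m := sch.side k) (by omega)]
    -- the left-hand side: `gramPairing · Tr K_u^S` through hand-2's insertion form
    obtain ⟨-, -, htrS⟩ := htrace (sch.side k) (by omega)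
    rw [hS.neg_one_pow, neg_one_mul, ← sub_eq_add_neg] at htrS
    rw [htrS, gramPairing_mul_diagCyclicTraceU_eq_integral_pairs r sch F k]
    refine integral_congr_ae (ae_of_all _ fun Q => ?_)
    dsimp only
    have hR : ∀ Q' : ZMod (sch.side k) → HalfCfg (sch.side k) (sch.side k) G × HalfCfg (sch.side k) (sch.side k) G,
        obsR (famRead r sch F k e) Q' = famObs r sch F k (torusLift (sch.side k) (layerAssembleU fun t => glue (Q' t).1 (Q' t).2)) :=
      fun Q' => obsR_famRead r sch F k e e (Nat.le_succ e) (by omega) hdep Q'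
    rw [← obsR_reflectPairs, hR, hR]
  · -- ★ the weight domination at chain length `2t + 2 d_k + 4`
    set e := famDepthSeq r sch F k with hedef
    rw [heven_sum F t]
    haveI : NeZero (2 * t + 2 * e + 4) := ⟨by omega⟩
    rw [hchain F (2 * t) (m := 2 * t + 2 * e + 4) rfl]
    obtain ⟨-, -, htr2⟩ := htrace (2 * t + 2 * e + 4) (by omega)
    rw [(show Even (2 * t + 2 * e + 4) from ⟨t + e + 2, by omega⟩).neg_one_pow, one_mul] at htr2
    rw [show 2 * t + 2 * (e + 2) = 2 * t + 2 * e + 4 by ring, htr2]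
    exact integral_obsLR_mul_pairChain_le (S := sch.side k) r.ρ r.continuous (sch.β k)
      (measurable_famRead r sch F k e) (abs_famRead_le r sch F k e hB)

end Slice

end Summit.QuantumFields.YangMills.Cruxes.DiagonalMirrorRPR.SignTwistedDiagonalTrace.WilsonDiagonal

end
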